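import Summits.ResolutionOfSingularities.ResolutionOfSingularities.Theorems.FrobeniusClosingPatchingRelPerfectDepthMultiHostFormat
import Literature.AlgebraicGeometry.Resolution.HypersurfaceRestrictionTransform
import Literature.AlgebraicGeometry.Resolution.HypersurfaceRestriction
import Literature.AlgebraicGeometry.Resolution.HypersurfaceTransform
import Literature.AlgebraicGeometry.Resolution.CartierDivisorControlledTransform
import Literature.AlgebraicGeometry.Resolution.GenericPointStalkData
import Literature.AlgebraicGeometry.Resolution.RegularBlowup
import Literature.AlgebraicGeometry.Resolution.MarkedIdeals
import HarnessLib

/-!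
# Crux `PatchingRelPerfect` (stmt-ResolutionOfSingularities-16161), chain W5.2 — F7(β) d = 2 (β-AX), target T3 `PhaseCTermination₂`:
# LEMMA R, THE CARRIER REDUCTION (Phase C near a pole is the marked ideal `(K|_G, 1)` on the bare carrier `G`)

[OURS · L1 W5.2 · res-L1-w52-lead-1 g6, X3 typer by res-L1-w52-plan-1 NOTE G11-20 (2) / RULING G11-30 (4); design res-L1-w52-idea-1
`X3-MEASURE-MEMO.md` inst. 1 (38ec7120fe0bf2e8) §1 Lemma R] Replaces the role of NO printed item; NOT a statement of the manuscript under
review; fact-free (tree restriction property of blow-ups only).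

FORMAT-LEVEL statement over `MultiHostState` (…DepthMultiHostFormat): `K = ⨆ᵢ host i · monomialIdeal (exps i)` on a regular `X`, and a
CARRIER `G ≤ K` — an ideal sheaf of a regular hypersurface (stalks `(v)`, `v ∉ 𝔪²`) lying below `K`; both sources of the memo give one
(a BARE host `host i₀ = G` with trivial monomial, or the exponent-one `N`-member: `G = host i₀ · monomialIdeal (exps i₀) ≤ K` by
`summand_le_K`).  Then:
* (R2) `support_K_subset_carrier` — `cosupp K ⊆ V(G)`: every Phase C centre `W ⊆ cosupp K` lies in the carrier; `K ≤ 𝓘_W`, `G ≤ 𝓘_W`.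
* (R3) `host_le_or_one_le_weightAt` — at the generic point `η` of such a `W`, every summand has its host inside `𝓘_W` or boundary
  weight `≥ 1`; hence weight `ν = 1` is LEGAL for every choice of host orders `m` that is `≥ 1` on the hosts containing `W`
  (`one_le_add_weightAt`), and `K_step` reads `K′ = τᶜ(K, 1)`.
* (R4) THE CARRIER STEP LAW — for the blowing up `τ` of `W` and any morphism `π_G : V(τᶜ(G,1)) → V(G)` over `τ` (it exists,
  `exists_carrier_hom`): `π_G` is the blowing up of the carrier along `𝓘_W|_G` (`isBlowup_carrier`, BGMW §4 Rem. (3)); the new state's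
  ideal restricts to the carrier as the weight-ONE controlled transform of the restriction, `K′|_{G′} = (π_G)ᶜ(K|_G, 1)`
  (`comap_carrier_K_step`, [Wlod] 3.10.3 = tree `IsBlowup.comap_subschemeι_controlledTransform`); the strict transform `G′ = τᶜ(G,1)`
  is again a carrier of the new state: `G′ ≤ K′` (`carrier_step_le_K`), a regular hypersurface on the regular `X′`
  (`carrier_step_hyp`, `carrier_step_isEffectiveCartier`).
By induction, Phase C near the pole is a sequence of blowings up OF THE CARRIER in regular centres inside `cosupp (K|_G, 1)` with `K|_G`
transforming as a marking-one ideal — the dictionary `M = N = P`, `𝓓 = {G} ∪ 𝓔` of RULING G11-30.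

USE (res-L1-w52-plan-1 NOTE G11-34 (a)): in X3 these lemmas are APPLIED WITH `S :=` THE RESIDUAL STATE (A8, `MultiHostState.residual`,
…DepthMultiHostResidual), where the bare host has trivial residual exponents, so `summand_le_K` gives `G ≤ S.residual.K` («`g ∈ K_res`» = (R2♭) of
record, RULING G11-30); `G ≤ S.K` for the un-factored `K` is false as soon as the minimal exponents are non-zero.

AI-written; AI review is weaker than expert review.

## References
* E. Bierstone, D. Grigoriev, P. Milman, J. Włodarczyk, arXiv:1206.3090, Lemma 3.6.4 (6), §4 Remark (3). [BierstoneGrigorievMilmanWlodarczyk2011]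
* J. Włodarczyk, *Simple Hironaka resolution in characteristic zero*, J. AMS 18 (2005), Lemma 3.10.3. [Wlodarczyk2005]
* J. Kollár, *Lectures on Resolution of Singularities* (2007), (3.111) Step 1. [Kollar2007]
-/

-- `Summit.<Summit>.<Sub>.Theorems` with `Sub = Summit` (single-conjunct summit, D-0017)
set_option linter.dupNamespace false

noncomputable section

open CategoryTheory AlgebraicGeometry TopologicalSpace IsLocalRing
open Literature.AlgebraicGeometry.Resolution
open Scheme.IdealSheafData

namespace Summit.ResolutionOfSingularities.ResolutionOfSingularities.Theorems.DepthMultiHost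

universe u

namespace MultiHostState

variable {X X' : Scheme.{u}} (S : MultiHostState X) {G : X.IdealSheafData}

/-! ## (R2) The cosupport lies in the carrier -/

/-- [OURS · L1 W5.2] **(R2)** `cosupp K ⊆ V(G)` for a carrier `G ≤ K`. [folklore] -/
theorem support_K_subset_carrier (hGK : G ≤ S.K) : (S.K.support : Set X) ⊆ G.support :=
  support_antitone hGK

/-- A centre inside the cosupport is inside the carrier: `G ≤ 𝓘_W`. [folklore] -/
theorem carrier_le_vanishingIdeal (hGK : G ≤ S.K) {W : Closeds X} (hW : (W : Set X) ⊆ S.K.support) :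
    G ≤ vanishingIdeal W :=
  le_support_iff_le_vanishingIdeal.mp (hW.trans (S.support_K_subset_carrier hGK))

/-- A centre inside the cosupport: `K ≤ 𝓘_W`. [folklore] -/
theorem K_le_vanishingIdeal {W : Closeds X} (hW : (W : Set X) ⊆ S.K.support) : S.K ≤ vanishingIdeal W :=
  le_support_iff_le_vanishingIdeal.mp hW

/-- Every summand vanishes on a centre inside the cosupport. [folklore] -/
theorem summand_le_vanishingIdeal {W : Closeds X} (hW : (W : Set X) ⊆ S.K.support) (i : Fin S.n) :
    S.host i * monomialIdeal (S.exps i) ≤ vanishingIdeal W :=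
  (S.summand_le_K i).trans (S.K_le_vanishingIdeal hW)

/-! ## (R3) Weight one is legal -/

/-- [OURS · L1 W5.2] **(R3)** At the generic point `η` of a centre `W ⊆ cosupp K`, every summand has its host inside `𝓘_W` or boundary
weight `≥ 1` (`𝓘_{W,η} = 𝔪_η` is prime and contains `host_η · monomial_η`). [cite: Kollar2007, (3.111) Step 1] -/
theorem host_le_or_one_le_weightAt {W : Closeds X} (hW : (W : Set X) ⊆ S.K.support) {η : X} (hη : IsGenericPoint η (W : Set X))
    (i : Fin S.n) : S.host i ≤ vanishingIdeal W ∨ 1 ≤ weightAt (S.exps i) η := by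
  have hle := stalkIdeal_mono (S.summand_le_vanishingIdeal hW i) η
  rw [stalkIdeal_mul, stalkIdeal_vanishingIdeal_eq_maximalIdeal_of_closure_eq hη.symm] at hle
  rcases (maximalIdeal.isMaximal (X.presheaf.stalk η)).isPrime.mul_le.mp hle with h | h
  · left
    have hsub : (W : Set X) ⊆ (S.host i).support := by
      rw [← hη]
      exact closure_minimal (Set.singleton_subset_iff.mpr ((mem_support_iff_stalkIdeal_le _ η).mpr h)) (S.host i).support.isClosed
    exact le_support_iff_le_vanishingIdeal.mp hsub
  · right
    have hsnc : HasSNC (boundaryOf (S.exps i)) := by rw [S.boundaryOf_exps i]; exact S.snc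
    refine (le_idealOrder_monomialIdeal_iff hsnc 1 η).mp ?_
    exact_mod_cast (one_le_idealOrder_iff _ η).mpr ((mem_support_iff_stalkIdeal_le _ η).mpr h)

/-- **Weight `ν = 1` is legal** for every choice of host orders `m` that is `≥ 1` on the hosts containing the centre.
[cite: Kollar2007, (3.111) Step 1] -/
theorem one_le_add_weightAt {W : Closeds X} (hW : (W : Set X) ⊆ S.K.support) {η : X} (hη : IsGenericPoint η (W : Set X))
    {m : Fin S.n → ℕ} (hm : ∀ i, S.host i ≤ vanishingIdeal W → 1 ≤ m i) (i : Fin S.n) :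
    1 ≤ m i + weightAt (S.exps i) η := by
  rcases S.host_le_or_one_le_weightAt hW hη i with h | h
  · exact (hm i h).trans (Nat.le_add_right _ _)
  · exact h.trans (Nat.le_add_left _ _)

/-! ## (R4) The carrier step law -/

section Step

variable [IsLocallyNoetherian X] (hX : Scheme.IsRegular X) {W : Closeds X} {η : X} {τ : X' ⟶ X} {m : Fin S.n → ℕ}
  (hGK : G ≤ S.K)
  (hGhyp : ∀ x ∈ G.support, ∃ v : X.presheaf.stalk x, stalkIdeal G x = Ideal.span {v} ∧ v ∉ (maximalIdeal (X.presheaf.stalk x)) ^ 2)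
  (hW : (W : Set X) ⊆ S.K.support) (hWreg : Scheme.IsRegular (vanishingIdeal W).subscheme)
  (hsnc : HasSNCWith S.𝓔 (vanishingIdeal W)) (hτ : IsBlowup τ (vanishingIdeal W))

omit [IsLocallyNoetherian X] in
/-- The induced morphism `π_G : V(τᶜ(G,1)) → V(G)` over `τ` exists. [cite: BierstoneGrigorievMilmanWlodarczyk2011, Lemma 3.6.4 (6)] -/
theorem exists_carrier_hom (τ : X' ⟶ X) (W : Closeds X) (G : X.IdealSheafData) :
    ∃ πG : (controlledTransform τ (vanishingIdeal W) G 1).subscheme ⟶ G.subscheme,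
      πG ≫ G.subschemeι = (controlledTransform τ (vanishingIdeal W) G 1).subschemeι ≫ τ :=
  exists_hom_subscheme_controlledTransform τ (vanishingIdeal W) G

include hX hGK hGhyp hW hWreg hτ in
/-- [OURS · L1 W5.2] **(R4a) The strict transform of the carrier is the blowing up of the carrier along `𝓘_W|_G`.**
[cite: BierstoneGrigorievMilmanWlodarczyk2011, §4 Remark (3)] -/
theorem isBlowup_carrier (πG : (controlledTransform τ (vanishingIdeal W) G 1).subscheme ⟶ G.subscheme)
    (hπG : πG ≫ G.subschemeι = (controlledTransform τ (vanishingIdeal W) G 1).subschemeι ≫ τ) :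
    IsBlowup πG ((vanishingIdeal W).comap G.subschemeι) :=
  hτ.isBlowup_subscheme_controlledTransform hX hWreg (S.carrier_le_vanishingIdeal hGK hW) hGhyp πG hπG

include hX hGK hGhyp hW hWreg in
/-- [OURS · L1 W5.2] **(R4b) THE CARRIER STEP LAW `K′|_{G′} = (π_G)ᶜ(K|_G, 1)`**: the ideal of the successor state (weight `ν = 1`)
restricts to the strict transform of the carrier as the weight-one controlled transform, along the blowing up `π_G` of the carrier, of
the restriction `K|_G` — restriction to a regular hypersurface through the centre commutes with the controlled transform.
[cite: Wlodarczyk2005, Lemma 3.10.3] [cite: BierstoneGrigorievMilmanWlodarczyk2011, Lemma 3.6.4 (6)] -/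
theorem comap_carrier_K_step (hη : IsGenericPoint η (W : Set X)) (hA : ∀ i, S.host i ≤ vanishingIdeal W ^ m i)
    (hν : ∀ i, 1 ≤ m i + weightAt (S.exps i) η)
    (πG : (controlledTransform τ (vanishingIdeal W) G 1).subscheme ⟶ G.subscheme)
    (hπG : πG ≫ G.subschemeι = (controlledTransform τ (vanishingIdeal W) G 1).subschemeι ≫ τ) :
    (S.step τ W η m 1 hsnc hτ).K.comap (controlledTransform τ (vanishingIdeal W) G 1).subschemeι =
      controlledTransform πG ((vanishingIdeal W).comap G.subschemeι) (S.K.comap G.subschemeι) 1 := by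
  rw [S.K_step τ W η m 1 hsnc hτ hη hA hν]
  refine hτ.comap_subschemeι_controlledTransform hX hWreg (S.carrier_le_vanishingIdeal hGK hW) hGhyp πG hπG ?_
  rw [pow_one]
  exact Scheme.IdealSheafData.comap_mono (f := τ) (S.K_le_vanishingIdeal hW)

include hGK in
/-- [OURS · L1 W5.2] **(R4c) The strict transform of the carrier is a carrier of the successor**: `τᶜ(G, 1) ≤ K′`. [folklore] -/
theorem carrier_step_le_K (hη : IsGenericPoint η (W : Set X)) (hA : ∀ i, S.host i ≤ vanishingIdeal W ^ m i)
    (hν : ∀ i, 1 ≤ m i + weightAt (S.exps i) η) :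
    controlledTransform τ (vanishingIdeal W) G 1 ≤ (S.step τ W η m 1 hsnc hτ).K := by
  rw [S.K_step τ W η m 1 hsnc hτ hη hA hν]
  exact colon_mono_left (Scheme.IdealSheafData.comap_mono (f := τ) hGK) _

include hX hGK hGhyp hW hWreg hτ in
/-- [OURS · L1 W5.2] **(R4d) The new carrier is a regular hypersurface**: order-one generators. [cite: BierstoneGrigorievMilmanWlodarczyk2011, Lemma 3.6.4 (4)] -/
theorem carrier_step_hyp (x' : X') (hx' : x' ∈ (controlledTransform τ (vanishingIdeal W) G 1).support) :
    ∃ w : X'.presheaf.stalk x', stalkIdeal (controlledTransform τ (vanishingIdeal W) G 1) x' = Ideal.span {w} ∧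
      w ∉ (maximalIdeal (X'.presheaf.stalk x')) ^ 2 :=
  hτ.exists_generator_notMem_sq_controlledTransform hX hWreg (S.carrier_le_vanishingIdeal hGK hW) hGhyp x' hx'

include hGK hW hτ in
omit [IsLocallyNoetherian X] in
/-- [OURS · L1 W5.2] **(R4e)** The new carrier is an effective Cartier divisor if the old one is. [folklore] -/
theorem carrier_step_isEffectiveCartier (hGc : IsEffectiveCartier G) :
    IsEffectiveCartier (controlledTransform τ (vanishingIdeal W) G 1) :=
  hτ.isEffectiveCartier_controlledTransform_of_le_pow hGc (by rw [pow_one]; exact S.carrier_le_vanishingIdeal hGK hW)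

include hX hWreg hτ in
/-- [OURS · L1 W5.2] **(R4f)** The blown-up ambient scheme is regular. [cite: Kollar2007, (3.111) Step 1] -/
theorem step_isRegular : Scheme.IsRegular X' :=
  hτ.isRegular_of_isRegular_subscheme hX hWreg

end Step

end MultiHostState

end Summit.ResolutionOfSingularities.ResolutionOfSingularities.Theorems.DepthMultiHost

end
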